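import Mathlib
import Literature.AlgebraicGeometry.Resolution.LocalBlowup
import Literature.AlgebraicGeometry.Resolution.QuadraticTransforms
import Literature.AlgebraicGeometry.Resolution.QuadraticTransformsRegular
import Literature.AlgebraicGeometry.Resolution.QuadraticTransformsStructure
import Literature.AlgebraicGeometry.Resolution.BlowupRingExceptionalFibre
import Literature.AlgebraicGeometry.Resolution.BlowupRingChartCoordinates
import Literature.AlgebraicGeometry.Resolution.RegularSystemOfParameters
import Literature.AlgebraicGeometry.Resolution.RidgeCone
import Summits.ResolutionOfSingularities.ResolutionOfSingularities.Theorems.RadicialJungCleanModelsLens5PRankTwoCurrency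
import Summits.ResolutionOfSingularities.ResolutionOfSingularities.Theorems.RadicialJungCleanModelsCleanLU3ArcPackage
import Summits.ResolutionOfSingularities.ResolutionOfSingularities.Theorems.RadicialJungCleanModelsConeExitPrelims
import Summits.ResolutionOfSingularities.ResolutionOfSingularities.Theorems.RadicialJungCleanModelsConeExitMorsePrelims
import Summits.ResolutionOfSingularities.ResolutionOfSingularities.Theorems.RadicialJungCleanModelsConeExitSmoothPrelims
import HarnessLib

/-!
# Route `RadicialJung`, crux `CleanModels` (stmt-15917), line `Sketch`: the SMOOTH-CONE EXIT — part 2/2: a stage whose tangent cone is a SMOOTH projective hypersurface of degree `e` prime to `p` is cleaned by ONE quadratic transform, for EVERY valuation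

Line lead `res-B-lead-1` g10, `--supports stmt-ResolutionOfSingularities-15917`.  Generalises ✓ `…ConeExitMorse` (`e = 2`) to every degree `e ≥ 1`: let `R ⊆ K` be a
regular local ring dominated by the valuation ring `O`, `t` a regular system of parameters, `F ∈ R[T₁,…,T_d]` homogeneous of degree `e` with
`h ≡ F(t) (mod 𝔪^{e+1})`, and assume the projectivised tangent cone `V(F̄) ⊂ ℙ^{d-1}_κ` is SMOOTH in the Jacobian sense «a power of the irrelevant ideal lies in
the ideal of the partials», lifted to `R` as: `t_i^N ≡ Σ_k b_{ik} · (∂_k F)(t) (mod 𝔪^{N+1})` with `b_{ik} ∈ 𝔪^{N+1-e}`.  Then in the quadratic transform along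
`O`, `h = x^e · G` with `G ∉ 𝔪₁² + (x)` — the centre of `O` is never a singular point of the cone (`not_coneVertex_of_smoothCone`) — and, on finitely generated
models with `p ∤ e`, `CleanLUConcl` holds (`cleanLUConcl_of_smoothCone`).  With ✓ `ConeExit.cleanLUConcl_or_firstReturn_of_cp2019BaseSidePhase` (every `p`):
after the printed base-side phase the dim-3 residual returns ONLY through SINGULAR points of SINGULAR tangent cones.

Proof = that of the Morse exit with `R[𝔪/x]/(x) ≅ κ[T̃]` (Stacks 0BIQ), the two ring homomorphisms `R[T] → R[𝔪/x]/(x)` («evaluate at `t/x`, reduce» and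
«reduce coefficients, dehomogenise, `ψ`») identified by `MvPolynomial.ringHom_ext`, forms scale (✓ `aeval_smul_of_isHomogeneous`), the chain rule and Euler
(part 1), and the abstract Jacobian argument.

Honest framing: OURS · counted 0 · nothing here proves resolution in characteristic `p`; no registered stub is closed.
-/

noncomputable section

set_option linter.dupNamespace false

open IsLocalRing MvPolynomial
open Literature.AlgebraicGeometry.Resolution
open Summit.ResolutionOfSingularities.ResolutionOfSingularities.Theorems.RadicialJung.CleanModels.Lens5.PRankTwoCurrency

namespace Summit.ResolutionOfSingularities.ResolutionOfSingularities.Theorems.RadicialJung.CleanModels.ConeExit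

universe u

/-! ## §1 The smooth-cone exit at ring level -/

section Ring

variable {K : Type u} [Field K]

/-- **THE SMOOTH-CONE EXIT (ring level): no return through a smooth projective tangent cone.**  `R ⊆ K` regular local dominated by `O`, `t` a regular system of
parameters, `F` homogeneous of degree `e ≥ 1` in `d` variables over `R`, `h ≡ F(t) (mod 𝔪^{e+1})`, and the SMOOTHNESS hypothesis `t_i^N ≡ Σ_k b_{ik}(∂_k F)(t)
(mod 𝔪^{N+1})`, `b_{ik} ∈ 𝔪^{N+1-e}` (`e ≤ N + 1`).  For `t_{i₀}` of minimal value and the quadratic transform `R₁ = (R[𝔪/t_{i₀}])_{𝔪_O ∩ …}` along `O`, the strict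
factor `G` (`h = t_{i₀}^e G`) satisfies `G ∉ 𝔪_{R₁}² + (t_{i₀})`. [folklore] -/
theorem not_coneVertex_of_smoothCone {O : ValuationSubring K} {R : Subring K} [IsRegularLocalRing R]
    (hdom : SubringDominates R O.toSubring)
    {d : ℕ} (hd : (maximalIdeal R).spanFinrank = d) (t : Fin d → R) (ht : Ideal.span (Set.range t) = maximalIdeal R)
    (F : MvPolynomial (Fin d) R) {e : ℕ} (hF : F.IsHomogeneous e) (he1 : 1 ≤ e)
    (h : R) (hQ : h - MvPolynomial.aeval t F ∈ maximalIdeal R ^ (e + 1))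
    {N : ℕ} (hN : e ≤ N + 1)
    (hsm : ∀ i, ∃ b : Fin d → R, (∀ k, b k ∈ maximalIdeal R ^ (N + 1 - e)) ∧
      t i ^ N - ∑ k, b k * MvPolynomial.aeval t (pderiv k F) ∈ maximalIdeal R ^ (N + 1))
    (i₀ : Fin d) (hmin : ∀ y ∈ maximalIdeal R, O.valuation (y : K) ≤ O.valuation (t i₀ : K))
    [IsLocalRing (locAtCentre (blowupRing R ((t i₀ : R) : K)) O)]
    (G : locAtCentre (blowupRing R ((t i₀ : R) : K)) O) (hG : (h : K) = ((t i₀ : R) : K) ^ e * (G : K)) :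
    G ∉ maximalIdeal (locAtCentre (blowupRing R ((t i₀ : R) : K)) O) ^ 2 ⊔
      Ideal.span {(⟨((t i₀ : R) : K), le_locAtCentre _ O (le_blowupRing R _ (t i₀).2)⟩ :
        locAtCentre (blowupRing R ((t i₀ : R) : K)) O)} := by
  classical
  have hRO : R ≤ O.toSubring := hdom.1
  have hx : t i₀ ∈ maximalIdeal R := ht ▸ Ideal.subset_span ⟨i₀, rfl⟩
  have hx0 : t i₀ ≠ 0 := rsop_ne_zero hd t ht i₀
  have hx0K : ((t i₀ : R) : K) ≠ 0 := fun h0 => hx0 (Subtype.ext h0)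
  have htm : ∀ j, t j ∈ maximalIdeal R := fun j => ht ▸ Ideal.subset_span ⟨j, rfl⟩
  -- the transform in the `t i₀`-chart: `R₁ = locAtCentre B O`, `B = R[𝔪/t i₀]`
  have hq' := isQuadraticTransformAlong_chart hRO (t i₀) hx hx0 hmin
  have hBR₁ : blowupRing R ((t i₀ : R) : K) ≤ locAtCentre (blowupRing R ((t i₀ : R) : K)) O := le_locAtCentre _ O
  have hBO : blowupRing R ((t i₀ : R) : K) ≤ O.toSubring := hBR₁.trans hq'.target_le
  have hRB : R ≤ blowupRing R ((t i₀ : R) : K) := le_blowupRing R _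
  have hxR₁ : ((t i₀ : R) : K) ∈ locAtCentre (blowupRing R ((t i₀ : R) : K)) O := hBR₁ (hRB (t i₀).2)
  let ι : R →+* blowupRing R ((t i₀ : R) : K) := Subring.inclusion hRB
  -- elements of `B`
  let xB : blowupRing R ((t i₀ : R) : K) := ⟨((t i₀ : R) : K), hRB (t i₀).2⟩
  have htB : ∀ j, ((t j : R) : K) / ((t i₀ : R) : K) ∈ blowupRing R ((t i₀ : R) : K) :=
    fun j => div_mem_blowupRing _ (htm j)
  let tB : Fin d → blowupRing R ((t i₀ : R) : K) := fun j => ⟨((t j : R) : K) / ((t i₀ : R) : K), htB j⟩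
  have htB0 : tB i₀ = 1 := Subtype.ext (div_self hx0K)
  -- evaluation at `t̃ = t/x` inside `B`, read in `K`
  let tK : Fin d → K := fun j => ((t j : R) : K)
  have htBK : (fun j => ((tB j : blowupRing R ((t i₀ : R) : K)) : K)) = ((t i₀ : R) : K)⁻¹ • tK := by
    funext j; simp [tB, tK, div_eq_inv_mul]
  have hevK : ∀ P : MvPolynomial (Fin d) R,
      ((eval₂Hom ι tB P : blowupRing R ((t i₀ : R) : K)) : K) = MvPolynomial.aeval (fun j => ((tB j : blowupRing R ((t i₀ : R) : K)) : K)) P := by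
    intro P
    have hφ : ((blowupRing R ((t i₀ : R) : K)).subtype.comp (eval₂Hom ι tB)) =
        (MvPolynomial.aeval (R := R) (fun j => ((tB j : blowupRing R ((t i₀ : R) : K)) : K))).toRingHom :=
      MvPolynomial.ringHom_ext (fun r => by simp [ι]; rfl) (fun j => by simp)
    exact congrArg (fun φ : MvPolynomial (Fin d) R →+* K => φ P) hφ
  have haevR : ∀ P : MvPolynomial (Fin d) R, ((MvPolynomial.aeval t P : R) : K) = MvPolynomial.aeval tK P := by
    intro P
    have := MvPolynomial.aeval_algebraMap_apply (B := K) t P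
    exact this.symm
  -- `h = x^e · G_B` with `G_B = F(t̃) + x r̃`
  obtain ⟨r, hr⟩ := exists_eq_pow_mul_of_mem_pow (R₁ := blowupRing R ((t i₀ : R) : K)) hx0K le_rfl hQ
  let GB : blowupRing R ((t i₀ : R) : K) := eval₂Hom ι tB F + xB * r
  have hscaleF : ((t i₀ : R) : K) ^ e * MvPolynomial.aeval (fun j => ((tB j : blowupRing R ((t i₀ : R) : K)) : K)) F =
      MvPolynomial.aeval tK F := by
    rw [htBK, aeval_smul_of_isHomogeneous hF, ← mul_assoc, ← mul_pow, mul_inv_cancel₀ hx0K, one_pow, one_mul]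
  have hhGB : (h : K) = ((t i₀ : R) : K) ^ e * (GB : K) := by
    have hrK : ((h - MvPolynomial.aeval t F : R) : K) = (h : K) - MvPolynomial.aeval tK F := by
      rw [AddSubgroupClass.coe_sub, haevR]
    rw [hrK] at hr
    have hGBK : (GB : K) = MvPolynomial.aeval (fun j => ((tB j : blowupRing R ((t i₀ : R) : K)) : K)) F +
        ((t i₀ : R) : K) * (r : K) := by
      simp only [GB, Subring.coe_add, Subring.coe_mul, hevK]
      rfl
    rw [hGBK, mul_add, hscaleF]
    have : ((t i₀ : R) : K) ^ e * (((t i₀ : R) : K) * (r : K)) = ((t i₀ : R) : K) ^ (e + 1) * (r : K) := by ring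
    rw [this, ← hr]
    ring
  have hGGB : G = ⟨(GB : K), hBR₁ GB.2⟩ := by
    apply Subtype.ext
    exact mul_left_cancel₀ (pow_ne_zero e hx0K) (hG.symm.trans hhGB)
  -- the polars in `B`: `D̃_k = (∂_k F)(t̃)`, with `(∂_k F)(t) = x^{e-1} D̃_k`
  let DB : Fin d → blowupRing R ((t i₀ : R) : K) := fun k => eval₂Hom ι tB (pderiv k F)
  have hscaleD : ∀ k, ((t i₀ : R) : K) ^ (e - 1) * ((DB k : blowupRing R ((t i₀ : R) : K)) : K) =
      ((MvPolynomial.aeval t (pderiv k F) : R) : K) := by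
    intro k
    rw [hevK, haevR, htBK, aeval_smul_of_isHomogeneous (hF.pderiv (i := k)), ← mul_assoc, ← mul_pow,
      mul_inv_cancel₀ hx0K, one_pow, one_mul]
  -- smoothness at `i₀`, divided by `x^N`: `1 = Σ b̃_k D̃_k + x m̃`
  obtain ⟨b, hb, hbsum⟩ := hsm i₀
  have hbx : ∀ k, ∃ b' : blowupRing R ((t i₀ : R) : K), ((b k : R) : K) = ((t i₀ : R) : K) ^ (N + 1 - e) * (b' : K) :=
    fun k => exists_eq_pow_mul_of_mem_pow (R₁ := blowupRing R ((t i₀ : R) : K)) hx0K le_rfl (hb k)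
  choose b' hb' using hbx
  obtain ⟨m', hm'⟩ := exists_eq_pow_mul_of_mem_pow (R₁ := blowupRing R ((t i₀ : R) : K)) hx0K le_rfl hbsum
  have hone : (1 : blowupRing R ((t i₀ : R) : K)) = ∑ k, b' k * DB k + xB * m' := by
    apply Subtype.ext
    have hmK : ((t i₀ : R) : K) ^ N - ∑ k, ((b k : R) : K) * ((MvPolynomial.aeval t (pderiv k F) : R) : K) =
        ((t i₀ : R) : K) ^ (N + 1) * (m' : K) := by
      rw [← hm']; simp
    have hlhs : (((∑ k, b' k * DB k + xB * m' : blowupRing R ((t i₀ : R) : K))) : K) =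
        ∑ k, (b' k : K) * ((DB k : blowupRing R ((t i₀ : R) : K)) : K) + ((t i₀ : R) : K) * (m' : K) := by
      simp [xB]
    rw [hlhs, OneMemClass.coe_one]
    -- multiply through by `x^N`
    apply mul_left_cancel₀ (pow_ne_zero N hx0K)
    have hNsplit : ((t i₀ : R) : K) ^ N = ((t i₀ : R) : K) ^ (N + 1 - e) * ((t i₀ : R) : K) ^ (e - 1) := by
      rw [← pow_add]; congr 1; omega
    have hterm : ∀ k, ((t i₀ : R) : K) ^ N * ((b' k : K) * ((DB k : blowupRing R ((t i₀ : R) : K)) : K)) =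
        ((b k : R) : K) * ((MvPolynomial.aeval t (pderiv k F) : R) : K) := by
      intro k
      rw [hb' k, ← hscaleD k, hNsplit]
      ring
    rw [mul_one, mul_add, Finset.mul_sum]
    simp_rw [hterm]
    have : ((t i₀ : R) : K) ^ N * (((t i₀ : R) : K) * (m' : K)) = ((t i₀ : R) : K) ^ (N + 1) * (m' : K) := by ring
    rw [this, ← hmK]
    ring
  -- the exceptional fibre `B/(x) ≅ κ[T̃]` and the two ring homomorphisms `R[T] → B/(x)`
  obtain ⟨ψ, hψbij, hψC, hψX⟩ := blowupRing_chartQuotient_X R hd t ht i₀ hx0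
  let I : Ideal (blowupRing R ((t i₀ : R) : K)) := Ideal.span {xB}
  let mk : blowupRing R ((t i₀ : R) : K) →+* blowupRing R ((t i₀ : R) : K) ⧸ I := Ideal.Quotient.mk I
  have hmkx : mk xB = 0 := Ideal.Quotient.eq_zero_iff_mem.mpr (Ideal.mem_span_singleton_self xB)
  let Tt : Fin d → MvPolynomial {j : Fin d // j ≠ i₀} (ResidueField R) :=
    fun i => if hi : i = i₀ then 1 else X ⟨i, hi⟩
  have hTt0 : Tt i₀ = 1 := by simp [Tt]
  have hTt : ∀ {i : Fin d} (hi : i ≠ i₀), Tt i = X ⟨i, hi⟩ := fun hi => by simp [Tt, hi]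
  have hψT : ∀ i, ψ (Tt i) = mk (tB i) := by
    intro i
    by_cases hi : i = i₀
    · subst hi
      rw [hTt0, map_one, htB0, map_one]
    · rw [hTt hi]
      exact hψX ⟨i, hi⟩ (htB i)
  let Fbar : MvPolynomial (Fin d) (ResidueField R) := MvPolynomial.map (residue R) F
  have hφ : ψ.comp ((MvPolynomial.aeval Tt).toRingHom.comp (MvPolynomial.map (residue R))) = mk.comp (eval₂Hom ι tB) := by
    refine MvPolynomial.ringHom_ext (fun r => ?_) (fun j => ?_)
    · simp only [RingHom.coe_comp, Function.comp_apply, MvPolynomial.map_C, AlgHom.toRingHom_eq_coe, RingHom.coe_coe,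
        MvPolynomial.aeval_C, MvPolynomial.algebraMap_eq, eval₂Hom_C]
      exact hψC r
    · simp only [RingHom.coe_comp, Function.comp_apply, MvPolynomial.map_X, AlgHom.toRingHom_eq_coe, RingHom.coe_coe,
        MvPolynomial.aeval_X, eval₂Hom_X']
      exact hψT j
  have hφP : ∀ P : MvPolynomial (Fin d) R, ψ (MvPolynomial.aeval Tt (MvPolynomial.map (residue R) P)) = mk (eval₂Hom ι tB P) :=
    fun P => congrArg (fun φ : MvPolynomial (Fin d) R →+* _ => φ P) hφ
  have hψG : ψ (MvPolynomial.aeval Tt Fbar) = mk GB := by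
    rw [hφP F]
    simp only [GB, map_add, map_mul, hmkx, zero_mul, add_zero]
  have hψD : ∀ k, ψ (MvPolynomial.aeval Tt (pderiv k Fbar)) = mk (DB k) := by
    intro k
    rw [show pderiv k Fbar = MvPolynomial.map (residue R) (pderiv k F) from pderiv_map, hφP]
  let eψ : MvPolynomial {j : Fin d // j ≠ i₀} (ResidueField R) ≃+* blowupRing R ((t i₀ : R) : K) ⧸ I :=
    RingEquiv.ofBijective ψ hψbij
  have he : ∀ z, eψ z = ψ z := fun z => rfl
  -- `1 = Σ β_k (∂_k F̄)(T̃)` in `κ[T̃]`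
  let β : Fin d → MvPolynomial {j : Fin d // j ≠ i₀} (ResidueField R) := fun k => eψ.symm (mk (b' k))
  have hβ : ∑ k, β k * MvPolynomial.aeval Tt (pderiv k Fbar) = 1 := by
    apply eψ.injective
    rw [map_one, map_sum]
    have h1 : mk (1 : blowupRing R ((t i₀ : R) : K)) = 1 := map_one mk
    rw [← h1, hone, map_add, map_mul mk xB, hmkx, zero_mul, add_zero, map_sum]
    refine Finset.sum_congr rfl fun k _ => ?_
    rw [map_mul, map_mul, he, he, hψD]
    congr 1
    rw [← he]
    exact eψ.apply_symm_apply _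
  -- suppose the centre IS a singular point of the cone
  intro hGt
  let 𝔫 : Ideal (blowupRing R ((t i₀ : R) : K)) := subringCentre _ O hBO
  haveI := isLocalization_locAtCentre (K := K) (O := O) hBO
  have hvx : O.valuation ((t i₀ : R) : K) < 1 := ((subringDominates_valuationSubring_iff hRO).mp hdom (t i₀)).mp hx
  have hx𝔫 : xB ∈ 𝔫 := (mem_subringCentre_iff hBO xB).mpr hvx
  have hGt' : ∃ s : blowupRing R ((t i₀ : R) : K), s ∉ 𝔫 ∧ s * GB ∈ 𝔫 ^ 2 ⊔ I := by
    have halg : algebraMap _ (locAtCentre (blowupRing R ((t i₀ : R) : K)) O) xB = ⟨((t i₀ : R) : K), hxR₁⟩ :=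
      Subtype.ext rfl
    have hmap : maximalIdeal (locAtCentre (blowupRing R ((t i₀ : R) : K)) O) ^ 2 ⊔
        Ideal.span {(⟨((t i₀ : R) : K), hxR₁⟩ : locAtCentre (blowupRing R ((t i₀ : R) : K)) O)} =
        (𝔫 ^ 2 ⊔ I).map (algebraMap _ (locAtCentre (blowupRing R ((t i₀ : R) : K)) O)) := by
      rw [Ideal.map_sup, Ideal.map_pow, IsLocalization.AtPrime.map_eq_maximalIdeal 𝔫 (locAtCentre (blowupRing R ((t i₀ : R) : K)) O),
        Ideal.map_span, Set.image_singleton, halg]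
    rw [hmap, IsLocalization.mem_map_algebraMap_iff 𝔫.primeCompl] at hGt
    obtain ⟨⟨⟨y', hy'⟩, ⟨s, hs⟩⟩, hys⟩ := hGt
    refine ⟨s, hs, ?_⟩
    have : s * GB = y' := by
      apply Subtype.ext
      have h1 := congrArg (fun z : locAtCentre (blowupRing R ((t i₀ : R) : K)) O => (z : K)) hys
      simp only [Subring.coe_mul] at h1
      rw [hGGB] at h1
      rw [Subring.coe_mul, mul_comm]
      exact h1
    rw [this]
    exact hy'
  obtain ⟨s, hs𝔫, hsG⟩ := hGt'
  let 𝔫bar : Ideal (blowupRing R ((t i₀ : R) : K) ⧸ I) := 𝔫.map mk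
  have hI𝔫 : I ≤ 𝔫 := (Ideal.span_singleton_le_iff_mem _).mpr hx𝔫
  haveI : 𝔫bar.IsPrime := Ideal.map_isPrime_of_surjective Ideal.Quotient.mk_surjective (by rwa [Ideal.mk_ker])
  have hcomap : 𝔫bar.comap mk = 𝔫 := by
    rw [Ideal.comap_map_of_surjective _ Ideal.Quotient.mk_surjective, ← RingHom.ker_eq_comap_bot, Ideal.mk_ker, sup_eq_left]
    exact hI𝔫
  have hmks : mk s ∉ 𝔫bar := fun hcon => hs𝔫 (by rw [← hcomap, Ideal.mem_comap]; exact hcon)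
  have hmksG : mk s * mk GB ∈ 𝔫bar ^ 2 := by
    rw [← map_mul]
    have : (𝔫 ^ 2 ⊔ I).map mk = 𝔫bar ^ 2 := by
      rw [Ideal.map_sup, Ideal.map_pow]
      have : I.map mk = ⊥ := by
        rw [Ideal.map_span, Set.image_singleton, Ideal.span_singleton_eq_bot]
        exact hmkx
      rw [this, sup_bot_eq]
    rw [← this]
    exact Ideal.mem_map_of_mem mk hsG
  let P : Ideal (MvPolynomial {j : Fin d // j ≠ i₀} (ResidueField R)) := 𝔫bar.comap eψ.toRingHom
  haveI : P.IsPrime := Ideal.comap_isPrime _ _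
  have hs'P : eψ.symm (mk s) ∉ P := by
    intro hcon
    rw [Ideal.mem_comap] at hcon
    exact hmks (by simpa using hcon)
  have hfbar : eψ.symm (mk GB) = MvPolynomial.aeval Tt Fbar := by
    rw [eψ.symm_apply_eq, he, hψG]
  have hsq : eψ.symm (mk s) * MvPolynomial.aeval Tt Fbar ∈ P ^ 2 := by
    rw [← hfbar, ← map_mul]
    exact symm_mem_sq_comap eψ 𝔫bar hmksG
  -- the Jacobian argument: chain rule for `k ≠ i₀`, Euler at `i₀`, `Σ β_k L_k = 1`
  have hFbar : Fbar.IsHomogeneous e := hF.map (residue R)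
  refine hs'P (mem_of_mul_mem_sq_of_polars (R := ResidueField R) i₀ (MvPolynomial.aeval Tt Fbar)
    (fun k => MvPolynomial.aeval Tt (pderiv k Fbar)) (fun k hk => ⟨pderiv ⟨k, hk⟩, pderiv_aeval_dehomog i₀ Fbar k hk⟩)
    (e : MvPolynomial {j : Fin d // j ≠ i₀} (ResidueField R)) (fun k => Tt k) ?_ β hβ P hsq)
  rw [aeval_pderiv_base_eq i₀ Fbar hFbar, nsmul_eq_mul]

/-- **THE SMOOTH-CONE EXIT, for the quadratic transform given as any subring** `R₁ = (R[𝔪/t_{i₀}])_{𝔪_O ∩ …}` (bookkeeping form). [folklore] -/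
theorem not_coneVertex_of_smoothCone' {O : ValuationSubring K} {R : Subring K} [IsRegularLocalRing R]
    (hdom : SubringDominates R O.toSubring)
    {d : ℕ} (hd : (maximalIdeal R).spanFinrank = d) (t : Fin d → R) (ht : Ideal.span (Set.range t) = maximalIdeal R)
    (F : MvPolynomial (Fin d) R) {e : ℕ} (hF : F.IsHomogeneous e) (he1 : 1 ≤ e)
    (h : R) (hQ : h - MvPolynomial.aeval t F ∈ maximalIdeal R ^ (e + 1))
    {N : ℕ} (hN : e ≤ N + 1)
    (hsm : ∀ i, ∃ b : Fin d → R, (∀ k, b k ∈ maximalIdeal R ^ (N + 1 - e)) ∧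
      t i ^ N - ∑ k, b k * MvPolynomial.aeval t (pderiv k F) ∈ maximalIdeal R ^ (N + 1))
    (i₀ : Fin d) (hmin : ∀ y ∈ maximalIdeal R, O.valuation (y : K) ≤ O.valuation (t i₀ : K))
    {R₁ : Subring K} (hR₁ : R₁ = locAtCentre (blowupRing R ((t i₀ : R) : K)) O) [IsLocalRing R₁]
    (hxR₁ : ((t i₀ : R) : K) ∈ R₁) (G : R₁) (hG : (h : K) = ((t i₀ : R) : K) ^ e * (G : K)) :
    G ∉ maximalIdeal R₁ ^ 2 ⊔ Ideal.span {(⟨((t i₀ : R) : K), hxR₁⟩ : R₁)} := by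
  subst hR₁
  exact not_coneVertex_of_smoothCone hdom hd t ht F hF he1 h hQ hN hsm i₀ hmin G hG

end Ring

/-! ## §2 Model level: `CleanLUConcl` through a stage with a smooth tangent cone of degree prime to `p` -/

/-- **SMOOTH-CONE EXIT ⟹ CLEAN.**  Finitely generated models `A ⊆ A' ⊆ O` of `K/k` with `R = locAtCentre A' O` regular of positive dimension, `t` a regular system of
parameters, `h = Σ_{j<p} c_j^p g₀^j ∈ R` a non-trivial representative of the `K^p`-line with `h ≡ F(t) (mod 𝔪^{e+1})`, `F` homogeneous of degree `e`, `p ∤ e`, and the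
smoothness hypothesis of `not_coneVertex_of_smoothCone`.  Then `CleanLUConcl p k K O A g₀` (form (1) on the quadratic transform, exponent `e`).  EVERY valuation ring
`O`, every ground field. [folklore] -/
theorem cleanLUConcl_of_smoothCone {p : ℕ} (hp : p.Prime) {k K : Type} [Field k] [Field K] [Algebra k K]
    (O : ValuationSubring K) (A A' : Subalgebra k K)
    (hA'O : A'.toSubring ≤ O.toSubring) (hAA' : A ≤ A') (hA'fg : A'.FG)
    (hreg : IsRegularLocalRing (locAtCentre A'.toSubring O)) (g₀ : K)
    (c : Fin p → K) (hc0 : ∃ j : Fin p, (j : ℕ) ≠ 0 ∧ c j ≠ 0)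
    (h : locAtCentre A'.toSubring O) (hc : ∑ j : Fin p, c j ^ p * g₀ ^ (j : ℕ) = (h : K))
    {d : ℕ} (hd0 : 0 < d) (hd : (maximalIdeal (locAtCentre A'.toSubring O)).spanFinrank = d)
    (t : Fin d → locAtCentre A'.toSubring O) (ht : Ideal.span (Set.range t) = maximalIdeal (locAtCentre A'.toSubring O))
    (F : MvPolynomial (Fin d) (locAtCentre A'.toSubring O)) {e : ℕ} (hF : F.IsHomogeneous e) (hpe : ¬ p ∣ e)
    (hQ : h - MvPolynomial.aeval t F ∈ maximalIdeal (locAtCentre A'.toSubring O) ^ (e + 1))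
    {N : ℕ} (hN : e ≤ N + 1)
    (hsm : ∀ i, ∃ b : Fin d → locAtCentre A'.toSubring O, (∀ k, b k ∈ maximalIdeal (locAtCentre A'.toSubring O) ^ (N + 1 - e)) ∧
      t i ^ N - ∑ k, b k * MvPolynomial.aeval t (pderiv k F) ∈ maximalIdeal (locAtCentre A'.toSubring O) ^ (N + 1)) :
    CleanLUConcl p k K O A g₀ := by
  classical
  haveI := hreg
  have he1 : 1 ≤ e := Nat.pos_of_ne_zero fun h0 => hpe (h0 ▸ dvd_zero p)
  have hRO : locAtCentre A'.toSubring O ≤ O.toSubring := locAtCentre_le hA'O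
  have hdom : SubringDominates (locAtCentre A'.toSubring O) O.toSubring := subringDominates_locAtCentre hA'O
  have htm : ∀ j, t j ∈ maximalIdeal (locAtCentre A'.toSubring O) := fun j => ht ▸ Ideal.subset_span ⟨j, rfl⟩
  have ht0 : ∀ j, ((t j : locAtCentre A'.toSubring O) : K) ≠ 0 := fun j h0 => rsop_ne_zero hd t ht j (Subtype.ext h0)
  obtain ⟨i₀, -, -, hmax⟩ := exists_max_valuation O Finset.univ (fun j => ((t j : locAtCentre A'.toSubring O) : K))
    ⟨⟨0, hd0⟩, Finset.mem_univ _, ht0 _⟩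
  have hmin : ∀ y ∈ maximalIdeal (locAtCentre A'.toSubring O), O.valuation (y : K) ≤ O.valuation (t i₀ : K) := by
    intro y hy
    rw [← ht] at hy
    induction hy using Submodule.span_induction with
    | mem y hy =>
      obtain ⟨j, rfl⟩ := hy
      exact hmax j (Finset.mem_univ j)
    | zero => simp
    | add y z _ _ hy hz =>
      rw [Subring.coe_add]
      exact (Valuation.map_add _ _ _).trans (max_le hy hz)
    | smul r y _ hy =>
      rw [smul_eq_mul, Subring.coe_mul, map_mul]
      calc O.valuation (r : K) * O.valuation (y : K) ≤ 1 * O.valuation (t i₀ : K) :=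
            mul_le_mul' ((O.valuation_le_one_iff _).mpr (hRO r.2)) hy
        _ = O.valuation (t i₀ : K) := one_mul _
  have hx : t i₀ ∈ maximalIdeal (locAtCentre A'.toSubring O) := htm i₀
  have hx0 : t i₀ ≠ 0 := rsop_ne_zero hd t ht i₀
  have hx0K : ((t i₀ : locAtCentre A'.toSubring O) : K) ≠ 0 := ht0 i₀
  have hq' := isQuadraticTransformAlong_chart hRO (t i₀) hx hx0 hmin
  obtain ⟨A'', hA''O, hAA'', -, hA''fg, hR₁A''⟩ :=
    exists_model_of_isLocalBlowup_with_input_le (A := A) hAA' hA'fg hq'.isLocalBlowup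
  have hT : blowupRing (locAtCentre A'.toSubring O) ((t i₀ : locAtCentre A'.toSubring O) : K) ≤ locAtCentre A''.toSubring O :=
    hR₁A'' ▸ le_locAtCentre _ O
  have hq'' := hq'
  rw [hR₁A''] at hq''
  have hreg₁ : IsRegularLocalRing (locAtCentre A''.toSubring O) := hq''.isRegularLocalRing_of_isRegularLocalRing hreg
  haveI := hreg₁
  obtain ⟨hxR₁, hxm₁, hx2₁⟩ := chart_notMem_sq_transform hq'' hdom (t i₀) hx hx0 hmin
  -- `h ∈ 𝔪^e`, so `h = x^e G`
  have haev : MvPolynomial.aeval t F ∈ maximalIdeal (locAtCentre A'.toSubring O) ^ e := by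
    rw [F.as_sum, map_sum]
    refine Ideal.sum_mem _ fun m hm => ?_
    rw [MvPolynomial.aeval_monomial, Finsupp.prod]
    have hdeg : ∑ i ∈ m.support, m i = e := (hF.degree_eq_sum_deg_support hm).symm
    have hprod : ∏ i ∈ m.support, t i ^ m i ∈ maximalIdeal (locAtCentre A'.toSubring O) ^ e := by
      rw [← hdeg, ← Finset.prod_pow_eq_pow_sum]
      exact Ideal.prod_mem_prod fun i _ => Ideal.pow_mem_pow (htm i) (m i)
    exact Ideal.mul_mem_left _ _ hprod
  have hhe : h ∈ maximalIdeal (locAtCentre A'.toSubring O) ^ e := by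
    have h3 : h - MvPolynomial.aeval t F ∈ maximalIdeal (locAtCentre A'.toSubring O) ^ e :=
      Ideal.pow_le_pow_right (Nat.le_succ e) hQ
    have := Ideal.add_mem _ h3 haev
    rwa [sub_add_cancel] at this
  obtain ⟨G, hG⟩ := exists_eq_pow_mul_of_mem_pow (R₁ := locAtCentre A''.toSubring O) hx0K hT hhe
  -- the smooth-cone exit on the chart ring, transported to the model ring
  have hGt : G ∉ maximalIdeal (locAtCentre A''.toSubring O) ^ 2 ⊔ Ideal.span {(⟨_, hxR₁⟩ : locAtCentre A''.toSubring O)} :=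
    not_coneVertex_of_smoothCone' hdom hd t ht F hF he1 h hQ hN hsm i₀ hmin hR₁A''.symm hxR₁ G hG
  by_cases hGu : IsUnit G
  · refine cleanLUConcl_of_unit_mul_pow O A A'' hA''O hAA'' hA''fg hreg₁ g₀ ⟨_, hxR₁⟩ hxm₁ hx2₁ G hGu e hpe c hc0 ?_
    rw [hc, hG, mul_comm]
  · have hGm : G ∈ maximalIdeal (locAtCentre A''.toSubring O) := (mem_maximalIdeal _).mpr hGu
    refine cleanLUConcl_of_unit_mul_pow_mul hp O A A'' hA''O hAA'' hA''fg hreg₁ g₀ ⟨_, hxR₁⟩ hxm₁ hx2₁ G hGm hGt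
      1 isUnit_one e hpe c hc0 ?_
    rw [hc, hG]
    simp

end Summit.ResolutionOfSingularities.ResolutionOfSingularities.Theorems.RadicialJung.CleanModels.ConeExit

end
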